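import Mathlib
import Literature.AlgebraicGeometry.Resolution.CobordantGame
import Literature.AlgebraicGeometry.Resolution.CobordantChartCoefficients
import Literature.AlgebraicGeometry.Resolution.FormalCoordinateChange
import Summits.ResolutionOfSingularities.ResolutionOfSingularities.Theorems.WeightedInvariantLocalWeightedDropAxisNormalize

/-!
# `WeightedInvariant.LocalWeightedDrop`, line `hasse-ridge-face-selection`: the pseudo-Weierstrass form of a germ with
# UNARY tangent cone (wild multiplicities included)

Crux item stmt-ResolutionOfSingularities-8899 `LocalWeightedDrop` (route `ResolutionOfSingularities/WeightedInvariant`),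
serving the door `WeightedConstruction` stmt-ResolutionOfSingularities-0571.  [OURS · L1 W4.3, chain w43, stub worker 3:
the normal-form helper for the wild surface cores of skeleton v18/v19 — CORE W″ pieces
`stub_charTwoDoublePointSurfaceWon` (N = 3, `p = d = 2`, Hauser's kangaroo) and `stub_wildUnaryConeSurfaceWon`
(N = 3, `p ∣ d ≥ 3`).  Not a statement of any manuscript.]

A germ `f ∈ k[[x_0, …, x_m]]` (`k` infinite) of order `≥ d` whose degree-`d` form is `λ · ℓ^d` for a non-zero covector
`ℓ` becomes, after the invertible LINEAR change `x ↦ M x` straightening `ℓ` to the last variable `y = X (Fin.last m)`,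
```
  f ∘ M = U · y^d + Σ_{j < d} a_j(x') · y^j,   U(0) = λ,   a_j ∈ k[[x']],   ord a_j > d - j
```
(`exists_normalForm`).  This is the shape in which Hironaka's characteristic polyhedron `Δ(f; x'; y)` is read (it lies
in `{|u| > 1}`), for EVERY multiplicity: no Tschirnhaus killing of the `y^{d-1}` term is attempted (for `p ∣ d` none
exists — Narasimhan / the kangaroo), and no Weierstrass preparation is used (`U` collects all monomials of `y`-degree
`≥ d`; it is a unit when `λ ≠ 0`, but is not `y`-free).  Compare `stub_tschirnhausForm` (tame multiplicities, where in
addition `a_{d-1} = 0`).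

Two entry points in the literal hypotheses of the registered cores:
* `normalForm_of_sq` — `ord f = 2` and square tangent quadric `(Σ ℓ_i x_i)²` (CORE W″ at `d = 2`; in characteristic `2`
  every diagonal quadric is such a square): `f ∘ M = U y² + a₁ y + a₀`, `U(0) = 1`, `ord a₁ ≥ 2`, `ord a₀ ≥ 3`;
* `normalForm_of_wideApex` — three variables, `ord f = d`, the degree-`d` form invariant under the translations by two
  linearly independent vectors `c₁, c₂` (CORE W″ at `d ≥ 3`, N = 3): then the form is `λ (c₁ × c₂ · x)^d`, `λ ≠ 0`
  (homogeneity propagates `ℤ`-translation invariance to the plane `k c₁ + k c₂`; `(u, c₁, c₂)` with `(c₁ × c₂) · u = 1` is a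
  basis by the triple product), and the normal form follows.

Steps: `exists_collect` (coefficient bookkeeping: `ord F ≥ d` and `y^d` the only degree-`d` monomial ⇒ the shape, with
`ord a_j > d - j`); `exists_matrix_vecMul_eq` (an invertible `M` with `ℓ M = e_y`, from `AxisNormalize.exists_matrix_lastCol`);
`coeff_of_initEval_eq` (over an infinite field the evaluated degree-`d` form `v ↦ λ v_y^d` determines the degree-`d`
coefficients, `MvPolynomial.funext`); `initEval_linearForm_pow`; and `AxisNormalize.initEval_subst_linSubst`
(`in_d (f ∘ M)(v) = in_d f (M v)`).

References (method only; the statements here are elementary and ours): Hironaka's characteristic polyhedron of a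
hypersurface singularity `Δ(f; x'; y)` [Hironaka 1967, Bowdoin; Cossart–Giraud–Orbanz LNM 1101]; Cossart–Schober,
arXiv:1411.4452 §2 (the polyhedron of a surface germ in Weierstrass-type coordinates) [corpus:paper:arxiv-1411.4452].
-/

set_option linter.dupNamespace false -- mandated namespace of this single-conjunct summit

namespace Summit.ResolutionOfSingularities.ResolutionOfSingularities.Theorems

open Literature.AlgebraicGeometry.Resolution

namespace UnaryConeForm

open MvPowerSeries

variable {k : Type} [Field k] {m : ℕ}

/-! ### Step A: collecting a germ whose degree-`d` form is `λ · y^d` -/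

/-- COLLECTION.  If `ord F ≥ d` and the only degree-`d` monomial of `F` is (possibly) `y^d` (`y = X (Fin.last m)`), then
`F = U · y^d + Σ_{j < d} a_j(x') · y^j` with `U(0)` the `y^d`-coefficient of `F`, the `a_j` series in the first `m`
variables, and `ord a_j > d - j` (no Weierstrass preparation: `U = Σ_{n ≥ d} F_{·,n} y^{n-d}` collects every monomial of
`y`-degree `≥ d`, `a_j` is the `y^j`-slice). -/
theorem exists_collect (F : MvPowerSeries (Fin (m + 1)) k) (d : ℕ) (hFo : (d : ℕ∞) ≤ F.order)
    (hdiag : ∀ E : Fin (m + 1) →₀ ℕ, E.degree = d → E ≠ Finsupp.single (Fin.last m) d → coeff E F = 0) :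
    ∃ (U : MvPowerSeries (Fin (m + 1)) k) (a : Fin d → MvPowerSeries (Fin m) k),
      constantCoeff U = coeff (Finsupp.single (Fin.last m) d) F ∧
      (∀ j : Fin d, ((d - (j : ℕ) : ℕ) : ℕ∞) < (a j).order) ∧
      F = U * X (Fin.last m) ^ d +
        ∑ j : Fin d, rename (Fin.succAboveEmb (Fin.last m)) (a j) * X (Fin.last m) ^ (j : ℕ) := by
  classical
  obtain ⟨U, hU⟩ : ∃ U : MvPowerSeries (Fin (m + 1)) k,
      ∀ E, coeff E U = coeff (E + Finsupp.single (Fin.last m) d) F :=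
    ⟨fun E => coeff (E + Finsupp.single (Fin.last m) d) F, fun _ => rfl⟩
  obtain ⟨a, ha⟩ : ∃ a : Fin d → MvPowerSeries (Fin m) k, ∀ (j : Fin d) (β : Fin m →₀ ℕ),
      coeff β (a j) = coeff (Finsupp.embDomain (Fin.succAboveEmb (Fin.last m)) β +
        Finsupp.single (Fin.last m) (j : ℕ)) F :=
    ⟨fun j β =>
      coeff (Finsupp.embDomain (Fin.succAboveEmb (Fin.last m)) β + Finsupp.single (Fin.last m) (j : ℕ)) F,
      fun _ _ => rfl⟩
  refine ⟨U, a, ?_, ?_, ?_⟩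
  · rw [← coeff_zero_eq_constantCoeff_apply, hU, zero_add]
  · -- `ord a_j > d - j`: below degree `d - j` by `ord F ≥ d`, in degree `d - j` by `hdiag`
    intro j
    refine lt_of_lt_of_le (ENat.coe_lt_coe.mpr (Nat.lt_succ_self _)) (nat_le_order fun β hβ => ?_)
    rw [ha]
    rcases Nat.lt_or_ge β.degree (d - (j : ℕ)) with hlt | hge
    · apply coeff_of_lt_order
      refine lt_of_lt_of_le ?_ hFo
      rw [TschirnhausForm.degree_emb_add_single]
      exact_mod_cast (by omega : β.degree + (j : ℕ) < d)
    · have hβd : β.degree = d - (j : ℕ) := by omega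
      refine hdiag _ ?_ ?_
      · rw [TschirnhausForm.degree_emb_add_single, hβd]
        have := j.2
        omega
      · intro h
        have h' := DFunLike.congr_fun h (Fin.last m)
        rw [TschirnhausForm.emb_add_single_last, Finsupp.single_eq_same] at h'
        have := j.2
        omega
  · -- `F = U y^d + Σ a_j y^j`, coefficient by coefficient at `x'^β y^n`
    ext E
    obtain ⟨β, hE⟩ := TschirnhausForm.exists_eq_emb_add_single E
    rw [hE]
    set n := E (Fin.last m) with hn
    have hC1 : coeff (Finsupp.embDomain (Fin.succAboveEmb (Fin.last m)) β + Finsupp.single (Fin.last m) n)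
        (U * X (Fin.last m) ^ d) = if d ≤ n then
          coeff (Finsupp.embDomain (Fin.succAboveEmb (Fin.last m)) β + Finsupp.single (Fin.last m) n) F else 0 := by
      rw [TschirnhausForm.coeff_emb_add_single_mul_X_pow]
      split_ifs with h
      · rw [hU, TschirnhausForm.emb_add_single_add_single, Nat.sub_add_cancel h]
      · rfl
    have hC2 : ∀ j : Fin d,
        coeff (Finsupp.embDomain (Fin.succAboveEmb (Fin.last m)) β + Finsupp.single (Fin.last m) n)
          (rename (Fin.succAboveEmb (Fin.last m)) (a j) * X (Fin.last m) ^ (j : ℕ)) = if (j : ℕ) = n then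
          coeff (Finsupp.embDomain (Fin.succAboveEmb (Fin.last m)) β + Finsupp.single (Fin.last m) n) F else 0 := by
      intro j
      rw [TschirnhausForm.coeff_emb_add_single_mul_X_pow]
      by_cases hj : (j : ℕ) = n
      · rw [if_pos hj.le, if_pos hj, TschirnhausForm.coeff_emb_add_single_rename, if_pos (by omega), ha, hj]
      · rw [if_neg hj]
        split_ifs with hle
        · rw [TschirnhausForm.coeff_emb_add_single_rename, if_neg (by omega)]
        · rfl
    rw [map_add, map_sum, hC1, Finset.sum_congr rfl (fun j _ => hC2 j),
      Fin.sum_univ_eq_sum_range (fun i => if i = n then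
        coeff (Finsupp.embDomain (Fin.succAboveEmb (Fin.last m)) β + Finsupp.single (Fin.last m) n) F else 0) d,
      Finset.sum_ite_eq']
    rcases Nat.lt_or_ge n d with h | h
    · rw [if_neg (by omega), if_pos (Finset.mem_range.mpr h), zero_add]
    · rw [if_pos h, if_neg (fun h' => absurd (Finset.mem_range.mp h') (by omega)), add_zero]


/-! ### Step B: straightening a non-zero linear form to the last variable -/

/-- For a non-zero covector `ℓ` there is an invertible matrix `M` with `ℓ M = e_y`; the linear substitution `x ↦ M x` then
carries the linear form `Σ ℓ_i x_i` to `y = X (Fin.last m)`. -/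
theorem exists_matrix_vecMul_eq (ℓ : Fin (m + 1) → k) (hℓ : ℓ ≠ 0) :
    ∃ M : Matrix (Fin (m + 1)) (Fin (m + 1)) k, IsUnit M.det ∧ Matrix.vecMul ℓ M = Pi.single (Fin.last m) 1 := by
  classical
  obtain ⟨N, hNdet, hNcol⟩ := AxisNormalize.exists_matrix_lastCol ℓ hℓ
  set P : Matrix (Fin (m + 1)) (Fin (m + 1)) k := N.transpose with hP
  have hPdet : IsUnit P.det := by rw [hP, Matrix.det_transpose]; exact hNdet
  refine ⟨P⁻¹, Matrix.isUnit_nonsing_inv_det _ hPdet, ?_⟩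
  have hrow : Matrix.vecMul (Pi.single (Fin.last m) (1 : k)) P = ℓ := by
    rw [Matrix.single_one_vecMul]
    funext j
    exact hNcol j
  calc Matrix.vecMul ℓ P⁻¹ = Matrix.vecMul (Matrix.vecMul (Pi.single (Fin.last m) (1 : k)) P) P⁻¹ := by rw [hrow]
    _ = Pi.single (Fin.last m) 1 := by rw [Matrix.vecMul_vecMul, Matrix.mul_nonsing_inv _ hPdet, Matrix.vecMul_one]

/-! ### Step C: the evaluated degree-`d` form determines the degree-`d` coefficients -/

/-- Over an infinite field, if the evaluated degree-`d` form of `G` is the function `v ↦ λ · v_y^d`, then the degree-`d`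
part of `G` is `λ · y^d` coefficientwise (`MvPolynomial.funext`). -/
theorem coeff_of_initEval_eq [Infinite k] (G : MvPowerSeries (Fin (m + 1)) k) (d : ℕ) (la : k)
    (hG : ∀ v : Fin (m + 1) → k,
      CobordantChart.initEval (fun _ : Fin (m + 1) => 1) v d G = la * v (Fin.last m) ^ d)
    {E : Fin (m + 1) →₀ ℕ} (hE : E.degree = d) :
    coeff E G = if E = Finsupp.single (Fin.last m) d then la else 0 := by
  classical
  set S := (Finset.univ : Finset (Fin (m + 1))).finsuppAntidiag d with hS
  set Q : MvPolynomial (Fin (m + 1)) k := ∑ α ∈ S, MvPolynomial.monomial α (coeff α G) with hQ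
  have hQeq : Q = MvPolynomial.monomial (Finsupp.single (Fin.last m) d) la := by
    refine MvPolynomial.funext fun v => ?_
    have hev : MvPolynomial.eval v Q = CobordantChart.initEval (fun _ : Fin (m + 1) => 1) v d G := by
      rw [ApexFreeOrderDrop.initEval_one_eq_sum, hQ, map_sum]
      refine Finset.sum_congr rfl fun α _ => ?_
      rw [MvPolynomial.eval_monomial, Finsupp.prod_pow]
    rw [hev, hG, MvPolynomial.eval_monomial]
    simp only [Finsupp.prod_single_index, pow_zero]
  have hcoeff : Q.coeff E = coeff E G := by
    rw [hQ, MvPolynomial.coeff_sum, Finset.sum_eq_single E]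
    · rw [MvPolynomial.coeff_monomial, if_pos rfl]
    · intro α _ hne
      rw [MvPolynomial.coeff_monomial, if_neg hne]
    · intro hES
      exfalso
      apply hES
      rw [Finset.mem_finsuppAntidiag, ← Finsupp.degree_eq_sum]
      exact ⟨hE, Finset.subset_univ _⟩
  rw [← hcoeff, hQeq, MvPolynomial.coeff_monomial]
  by_cases h : E = Finsupp.single (Fin.last m) d
  · rw [if_pos h.symm, if_pos h]
  · rw [if_neg (Ne.symm h), if_neg h]

/-! ### Step D: the evaluated degree-`d` form of a power of a linear form -/

/-- `in_d ((Σ ℓ_i x_i)^d) (v) = (Σ ℓ_i v_i)^d`. -/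
theorem initEval_linearForm_pow (ℓ v : Fin (m + 1) → k) (d : ℕ) :
    CobordantChart.initEval (fun _ : Fin (m + 1) => 1) v d
        ((∑ i, C (ℓ i) * X i : MvPowerSeries (Fin (m + 1)) k) ^ d) = dotProduct ℓ v ^ d := by
  classical
  have h0 : ∀ i, constantCoeff (v i • (X (Fin.last m) : MvPowerSeries (Fin (m + 1)) k)) = 0 := fun i => by
    rw [smul_eq_C_mul, map_mul, constantCoeff_X, mul_zero]
  have hs : HasSubst (fun i => v i • (X (Fin.last m) : MvPowerSeries (Fin (m + 1)) k)) :=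
    hasSubst_of_constantCoeff_zero h0
  rw [AxisNormalize.initEval_eq_coeff_subst_smul_X (Fin.last m), ← coe_substAlgHom hs, map_pow, map_sum]
  have hlin : ∑ i, substAlgHom hs (C (ℓ i) * X i) = C (dotProduct ℓ v) * X (Fin.last m) := by
    rw [dotProduct, map_sum, Finset.sum_mul]
    refine Finset.sum_congr rfl fun i _ => ?_
    rw [map_mul, substAlgHom_X, coe_substAlgHom, subst_C, smul_eq_C_mul, ← mul_assoc, ← map_mul]
  rw [hlin, mul_pow, ← map_pow, coeff_C_mul, coeff_X_pow, if_pos rfl, mul_one]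

/-! ### The normal form -/

/-- THE PSEUDO-WEIERSTRASS FORM OF A GERM WITH UNARY TANGENT CONE (every multiplicity, wild ones included; `k`
infinite).  If `ord f ≥ d` and the degree-`d` form of `f` is `λ · ℓ^d` as a function (`ℓ ≠ 0` a covector), then after the
invertible LINEAR change `x ↦ M x` straightening `ℓ` to `y = X (Fin.last m)`:
`f ∘ M = U · y^d + Σ_{j < d} a_j(x') · y^j` with `U(0) = λ`, the `a_j` in the first `m` variables and `ord a_j > d - j`
(the polyhedron `Δ(f∘M; x'; y)` lies strictly inside `{|u| > 1}`; for `λ ≠ 0` this is `U` a unit).  No `y^{d-1}`-killing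
(Tschirnhaus) is attempted — for `p ∣ d` none exists. -/
theorem exists_normalForm [Infinite k] (f : MvPowerSeries (Fin (m + 1)) k) (d : ℕ) (hfo : (d : ℕ∞) ≤ f.order)
    (ℓ : Fin (m + 1) → k) (hℓ : ℓ ≠ 0) (la : k)
    (hcone : ∀ v : Fin (m + 1) → k,
      CobordantChart.initEval (fun _ : Fin (m + 1) => 1) v d f = la * dotProduct ℓ v ^ d) :
    ∃ (M : Matrix (Fin (m + 1)) (Fin (m + 1)) k) (U : MvPowerSeries (Fin (m + 1)) k)
      (a : Fin d → MvPowerSeries (Fin m) k),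
      IsUnit M.det ∧ constantCoeff U = la ∧
      (∀ j : Fin d, ((d - (j : ℕ) : ℕ) : ℕ∞) < (a j).order) ∧
      subst (FormalCoordChange.linSubst M) f = U * X (Fin.last m) ^ d +
        ∑ j : Fin d, rename (Fin.succAboveEmb (Fin.last m)) (a j) * X (Fin.last m) ^ (j : ℕ) := by
  classical
  obtain ⟨M, hMdet, hℓM⟩ := exists_matrix_vecMul_eq ℓ hℓ
  set F := subst (FormalCoordChange.linSubst M) f with hF
  have hFo : (d : ℕ∞) ≤ F.order :=
    ConeDichotomy.le_order_subst_of_le _ (ConeDichotomy.constantCoeff_linSubst M) f _ hfo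
  have hFin : ∀ v : Fin (m + 1) → k,
      CobordantChart.initEval (fun _ : Fin (m + 1) => 1) v d F = la * v (Fin.last m) ^ d := by
    intro v
    rw [hF, AxisNormalize.initEval_subst_linSubst (Fin.last m), hcone, Matrix.dotProduct_mulVec, hℓM,
      single_dotProduct, one_mul]
  have hdiag : ∀ E : Fin (m + 1) →₀ ℕ, E.degree = d → E ≠ Finsupp.single (Fin.last m) d → coeff E F = 0 :=
    fun E hE hne => by rw [coeff_of_initEval_eq F d la hFin hE, if_neg hne]
  obtain ⟨U, a, hU, ha, hFeq⟩ := exists_collect F d hFo hdiag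
  refine ⟨M, U, a, hMdet, ?_, ha, hFeq⟩
  rw [hU, coeff_of_initEval_eq F d la hFin (Finsupp.degree_single _ _), if_pos rfl]


/-! ### From `ord f = d`: a non-zero degree-`d` coefficient -/

/-- A series of order exactly `d` has a non-zero coefficient in degree `d`. -/
theorem exists_coeff_ne_zero_of_order_eq {N : ℕ} {f : MvPowerSeries (Fin N) k} {d : ℕ} (hfd : f.order = d) :
    ∃ E : Fin N →₀ ℕ, E.degree = d ∧ coeff E f ≠ 0 := by
  obtain ⟨E, hE, hdeg⟩ := exists_coeff_ne_zero_and_order (f := f) (by rw [hfd, ENat.toNat_coe])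
  rw [hfd] at hdeg
  exact ⟨E, by exact_mod_cast hdeg, hE⟩

/-! ### Entry point for the wild surface cores, `d = 2`: square tangent quadric -/

/-- NORMAL FORM OF A DOUBLE POINT WITH SQUARE TANGENT QUADRIC (every characteristic, `k` infinite; the entry point of
CORE W″ piece `stub_charTwoDoublePointSurfaceWon`, where `p = 2`).  If `ord f = 2` and the tangent quadric of `f` is the
square `(Σ ℓ_i x_i)²`, then `ℓ ≠ 0` and after an invertible linear change `x ↦ M x`:
`f ∘ M = U · y² + a₁(x') · y + a₀(x')` with `U(0) = 1`, `ord a₁ ≥ 2`, `ord a₀ ≥ 3` (`y = X (Fin.last m)`). -/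
theorem normalForm_of_sq [Infinite k] (f : MvPowerSeries (Fin (m + 1)) k) (hf2 : f.order = 2)
    (ℓ : Fin (m + 1) → k)
    (hsq : ∀ i j : Fin (m + 1), coeff (Finsupp.single i 1 + Finsupp.single j 1) f =
      coeff (Finsupp.single i 1 + Finsupp.single j 1) ((∑ l, C (ℓ l) * X l : MvPowerSeries (Fin (m + 1)) k) ^ 2)) :
    ∃ (M : Matrix (Fin (m + 1)) (Fin (m + 1)) k) (U : MvPowerSeries (Fin (m + 1)) k) (a₀ a₁ : MvPowerSeries (Fin m) k),
      IsUnit M.det ∧ constantCoeff U = 1 ∧ (2 : ℕ∞) < a₀.order ∧ (1 : ℕ∞) < a₁.order ∧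
      subst (FormalCoordChange.linSubst M) f = U * X (Fin.last m) ^ 2 +
        (rename (Fin.succAboveEmb (Fin.last m)) a₀ + rename (Fin.succAboveEmb (Fin.last m)) a₁ * X (Fin.last m)) := by
  classical
  -- every degree-`2` coefficient of `f` is that of `L²`
  have hdeg2 : ∀ E : Fin (m + 1) →₀ ℕ, E.degree = 2 →
      coeff E f = coeff E ((∑ l, C (ℓ l) * X l : MvPowerSeries (Fin (m + 1)) k) ^ 2) := by
    intro E hE
    obtain ⟨i, j, rfl⟩ := ConeDichotomy.exists_eq_single_add_single E hE
    exact hsq i j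
  -- `ℓ ≠ 0`
  have hℓ : ℓ ≠ 0 := by
    obtain ⟨E, hE, hc⟩ := exists_coeff_ne_zero_of_order_eq hf2
    rintro rfl
    apply hc
    rw [hdeg2 E hE]
    simp
  -- the degree-`2` form as a function: `(ℓ · v)²`
  have hcone : ∀ v : Fin (m + 1) → k,
      CobordantChart.initEval (fun _ : Fin (m + 1) => 1) v 2 f = 1 * dotProduct ℓ v ^ 2 := by
    intro v
    rw [one_mul, ← initEval_linearForm_pow ℓ v 2, ApexFreeOrderDrop.initEval_one_eq_sum,
      ApexFreeOrderDrop.initEval_one_eq_sum]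
    refine Finset.sum_congr rfl fun E hE => ?_
    rw [hdeg2 E]
    rw [Finset.mem_finsuppAntidiag] at hE
    rw [Finsupp.degree_eq_sum]
    exact hE.1
  obtain ⟨M, U, a, hMdet, hU, ha, hfeq⟩ := exists_normalForm f 2 hf2.symm.le ℓ hℓ 1 hcone
  refine ⟨M, U, a 0, a 1, hMdet, hU, ?_, ?_, ?_⟩
  · have := ha 0
    simpa using this
  · have := ha 1
    simpa using this
  · rw [hfeq, Fin.sum_univ_two]
    simp only [Fin.val_zero, pow_zero, mul_one, Fin.val_one, pow_one]

/-! ### Entry point for the wild surface cores, `d ≥ 3` in three variables: a wide apex is a unary cone -/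

/-- NORMAL FORM OF A SURFACE GERM WITH WIDE APEX (three variables, every characteristic, `k` infinite; the entry point of
CORE W″ piece `stub_wildUnaryConeSurfaceWon`).  If `ord f = d` and the degree-`d` form of `f ∈ k[[x₀,x₁,x₂]]` is invariant
under the translations by two linearly independent vectors `c₁, c₂`, then it is `λ · ℓ^d` with `ℓ = c₁ × c₂ ≠ 0` and
`λ ≠ 0` (translation invariance by `c` propagates to the line `k c` by homogeneity, and `(c₁, c₂, u)` with `ℓ · u = 1` is
a basis), so after an invertible linear change `x ↦ M x`:
`f ∘ M = U · y^d + Σ_{j < d} a_j(x') · y^j`, `U(0) ≠ 0`, `ord a_j > d - j` (`y = X (Fin.last 2)`). -/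
theorem normalForm_of_wideApex [Infinite k] (f : MvPowerSeries (Fin 3) k) (d : ℕ) (hfd : f.order = d)
    (c₁ c₂ : Fin 3 → k) (hind : ∀ α β : k, α • c₁ + β • c₂ = 0 → α = 0 ∧ β = 0)
    (h₁ : ∀ v : Fin 3 → k, CobordantChart.initEval (fun _ : Fin 3 => 1) (v + c₁) d f =
      CobordantChart.initEval (fun _ : Fin 3 => 1) v d f)
    (h₂ : ∀ v : Fin 3 → k, CobordantChart.initEval (fun _ : Fin 3 => 1) (v + c₂) d f =
      CobordantChart.initEval (fun _ : Fin 3 => 1) v d f) :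
    ∃ (M : Matrix (Fin 3) (Fin 3) k) (U : MvPowerSeries (Fin 3) k) (a : Fin d → MvPowerSeries (Fin 2) k),
      IsUnit M.det ∧ constantCoeff U ≠ 0 ∧
      (∀ j : Fin d, ((d - (j : ℕ) : ℕ) : ℕ∞) < (a j).order) ∧
      subst (FormalCoordChange.linSubst M) f = U * X (Fin.last 2) ^ d +
        ∑ j : Fin d, rename (Fin.succAboveEmb (Fin.last 2)) (a j) * X (Fin.last 2) ^ (j : ℕ) := by
  classical
  -- `ℓ = c₁ × c₂ ≠ 0`, orthogonal to `c₁, c₂`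
  set ℓ : Fin 3 → k := crossProduct c₁ c₂ with hℓdef
  have hℓ : ℓ ≠ 0 := crossProduct_ne_zero_iff_linearIndependent.mpr (LinearIndependent.pair_iff.mpr hind)
  have hℓ₁ : dotProduct ℓ c₁ = 0 := by rw [dotProduct_comm]; exact dot_self_cross c₁ c₂
  have hℓ₂ : dotProduct ℓ c₂ = 0 := by rw [dotProduct_comm]; exact dot_cross_self c₁ c₂
  -- `u` with `ℓ · u = 1`
  obtain ⟨i₀, hi₀⟩ := Function.ne_iff.mp hℓ
  set u : Fin 3 → k := Pi.single i₀ (ℓ i₀)⁻¹ with hudef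
  have hℓu : dotProduct ℓ u = 1 := by rw [hudef, dotProduct_single, mul_inv_cancel₀ hi₀]
  -- `(u, c₁, c₂)` is a basis: every `v` is `γ u + α c₁ + β c₂`
  set R : Matrix (Fin 3) (Fin 3) k := ![u, c₁, c₂] with hRdef
  have hRdet : IsUnit R.det := by
    rw [hRdef, ← triple_product_eq_det, dotProduct_comm, hℓu]
    exact isUnit_one
  have hRTdet : IsUnit R.transpose.det := by rw [Matrix.det_transpose]; exact hRdet
  have hdecomp : ∀ v : Fin 3 → k, ∃ x : Fin 3 → k, v = x 0 • u + x 1 • c₁ + x 2 • c₂ := by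
    intro v
    refine ⟨R.transpose⁻¹.mulVec v, ?_⟩
    set x := R.transpose⁻¹.mulVec v with hx
    have hv : v = R.transpose.mulVec x := (AxisNormalize.mulVec_nonsing_inv_mulVec hRTdet v).symm
    rw [hv, Matrix.mulVec_transpose]
    funext j
    simp [Matrix.vecMul, dotProduct, Fin.sum_univ_three, hRdef]
  -- the degree-`d` form as a function: `λ (ℓ · v)^d` with `λ = in_d f (u)`
  set la := CobordantChart.initEval (fun _ : Fin 3 => 1) u d f with hla
  have hcone : ∀ v : Fin 3 → k, CobordantChart.initEval (fun _ : Fin 3 => 1) v d f = la * dotProduct ℓ v ^ d := by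
    intro v
    obtain ⟨x, rfl⟩ := hdecomp v
    rw [AxisNormalize.initEval_add_smul h₂, AxisNormalize.initEval_add_smul h₁, AxisNormalize.initEval_smul]
    simp only [dotProduct_add, dotProduct_smul, smul_eq_mul, hℓu, hℓ₁, hℓ₂, mul_one, mul_zero, add_zero]
    rw [mul_comm]
  -- `λ ≠ 0` since `ord f = d`
  have hla0 : la ≠ 0 := by
    intro h0
    obtain ⟨E, hE, hc⟩ := exists_coeff_ne_zero_of_order_eq hfd
    apply hc
    have hG : ∀ v : Fin 3 → k, CobordantChart.initEval (fun _ : Fin 3 => 1) v d f = 0 * v (Fin.last 2) ^ d := by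
      intro v
      rw [hcone, h0, zero_mul, zero_mul]
    rw [coeff_of_initEval_eq f d 0 hG hE]
    split_ifs <;> rfl
  obtain ⟨M, U, a, hMdet, hU, ha, hfeq⟩ := exists_normalForm f d hfd.symm.le ℓ hℓ la hcone
  exact ⟨M, U, a, hMdet, by rw [hU]; exact hla0, ha, hfeq⟩

end UnaryConeForm

end Summit.ResolutionOfSingularities.ResolutionOfSingularities.Theorems
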